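import Summits.BirchSwinnertonDyer.BirchSwinnertonDyer.Theorems.ByReductionTypeAtTwoMultTransportTwistedDescentHTwoBound
import Literature.NumberTheory.EllipticCurves.ZpExtensionGaloisTwistLevelDualProofs
import Literature.NumberTheory.GaloisRepresentations.ContinuousRepHomDual
import HarnessLib

/-!
# T-42 in the kernel, LXXVII-a — road (S-C′), brick B2′ (tools): the level-change tail on the dual side, the new LOCAL input
# «`σ₀`-fixed elements of `Hom(C(χ_u), μ)` are killed by `u − 1`» for a Greenberg line `C`, and the model hypothesis from its
# `p`-torsion form

Cell `bsd-2adic` (run/shared/lean/pub/bsd-2adic/), seat `bsd-2adic-t42` GEN 32 (pen RC-521 «(S-C′) FUNDED», memo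
`t42/DESIGN-T42-ADDENDUM-35.md` §A35.8 B2′; audit-2 D-NOTE SC-NEG@2 §4 (R-ker)). HONEST FRAMING: research route; THEOREMS ONLY
(no `def`, no named fact, no instance, no `sorry`); nothing booked; no door or class file is touched; BSD is not proved by any of
this. PARTITION: X5@2 multiplicative GV-transport rows (K4ᵐ B1·O1; the PRINT binder F1) × p = 2 — reduces-the-named-input-of;
bears_on K4 items 19922 / 19923 (`--supports stmt-BirchSwinnertonDyer-19923`). Three tools for the sibling
`…TwistedDescentLevelDualAtTwo` (the dual-side change of level `H¹(ι^D) y = 0` from the local dual Kummer condition at a line):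

* §1 `map_twistedTorsionInclDual_oneCocycleClass_eq_zero` — the cocycle tail of `map_twistedTorsionInclDual_eq_zero_of_res_eq_zero`
  (`ZpExtensionGaloisTwistLevelDualProofs`) as a lemma: `p^{J−j} φ = ∂m` and `p^j m = 0` give `H¹(ι^D)[φ] = 0` (descend `m` through `π`).
* §2 `sub_one_zsmul_homRep_line_apply_eq_zero`, **`pow_natAbs_smul_eq_zero_of_homRep_line_apply_eq_self`** — for a cyclic
  `χ_u`-twisted line `C ⊆ E[p^J]` at `v` on which some `σ₀ ∈ Γ_{K_v}` over the topological generator acts through its exponent on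
  `μ_{p^J}` (the Tate line / the reduction-datum line: package (iv) of XXXVII / LXIII with XXXIV's inertial `σ₀`), every element of
  `Hom(C(χ_u), μ_{p^J})` FIXED by `σ₀` is killed by `u − 1`, hence by `p^{|u−1|}` (`u ≠ 1`) — the computation inside XXXVIII's
  `natCard_two_line_le` («`a·f(c) = σ₀ f(c) = f(σ₀ ⋆ c) = u a·f(c)`»), any number field, any `p`. This replaces Greenberg's
  «`H⁰(F_{v₀}, M*)` finite» (p. 125) at an omitted prime by a statement AT THE PLACE ABOVE `p`.
* §3 `forall_twisted_apply_eq_self_line_eq_zero_of_prime_torsion` — the MODEL HYPOTHESIS of road (S-C′) («no twisted `Γ_K`-invariant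
  point of `E[p^J]` on the line», every `J`, every twist) from its `p`-torsion form «no `Γ_K`-fixed point of order `p` on the line»
  (for `E/ℚ` with `E(ℚ)[2] = {0, P₀}`: «`P₀ ∉ C₂`», k5; vacuous when `E(K)[p] = 0`).

References: [GreenbergLNM1716] §4 Prop. 4.13 and pp. 121–125; [SerreGaloisCohomology1997] I §2.2, II §5.2; [MilneADT2006] I §0, §2.
-/

set_option autoImplicit false
set_option linter.dupNamespace false

noncomputable section

open scoped Classical AddSubgroup ContRepresentation

namespace Summit.BirchSwinnertonDyer.BirchSwinnertonDyer.Theorems.MultTransportTwistedDescent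

open NumberField IsDedekindDomain Field WeierstrassCurve CategoryTheory Function
  Literature.NumberTheory.GaloisRepresentations Literature.NumberTheory.EllipticCurves
  Literature.NumberTheory.EllipticCurves.GreenbergSelmer IsDedekindDomain.HeightOneSpectrum
  Summit.BirchSwinnertonDyer.Rank1Residual.X2 ContinuousCohomology
open Literature.NumberTheory.GaloisRepresentations.DiscreteGaloisModule (localTatePairingZMod localTatePairing
  TateDual tateDual mu MuCarrier)

/-! ## §1 The tail of the level-change: `p^{J−j} φ = ∂m`, `p^j m = 0` ⟹ `H¹(ι^D)[φ] = 0` -/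

section Tail

variable {K : Type} [Field K] (W : WeierstrassCurve K) [W.IsElliptic] (p : ℕ) [Fact p.Prime]
  (κ : ZpExtension K p) {j J : ℕ} (hjJ : j ≤ J) (u : ℤ) (hu : (p : ℤ) ∣ u - 1)
  [Finite (W.geomTorsion ((p ^ j : ℕ) : ℤ))] [Finite (W.geomTorsion ((p ^ J : ℕ) : ℤ))]

/-- **`H¹(ι^D)[φ] = 0` from a coboundary identity `p^{J−j} φ = ∂m` with `p^j m = 0`** (the cocycle tail of
`map_twistedTorsionInclDual_eq_zero_of_res_eq_zero`: `m` kills `ker π = E[p^J][p^{J−j}] ⊆ p^j E[p^J]`, so `m = m' ∘ π` and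
`ι^D ∘ φ = ∂m'`); granted the divisibility of `E(K̄)`. [cite: GreenbergLNM1716, §4 pp. 123–125] [cite: SerreGaloisCohomology1997, I §2.2] -/
theorem map_twistedTorsionInclDual_oneCocycleClass_eq_zero (hdiv : W.zsmul_geomPoints_surjective)
    (φ : contOneCocycles ((W.twistedTorsionGaloisModule p κ J u hu).tateDual (p ^ J)).toTopRep)
    (m : TateDual K (W.geomTorsion ((p ^ J : ℕ) : ℤ)) (p ^ J))
    (hm' : ∀ g : absoluteGaloisGroup K, ((p ^ (J - j) : ℕ) : ℤ) • φ.1 g =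
      ((W.twistedTorsionGaloisModule p κ J u hu).tateDual (p ^ J)) g m - m)
    (hjm : ((p ^ j : ℕ) : ℤ) • m = 0) :
    galoisCohomology.map (W.twistedTorsionInclDual p κ hjJ u hu) 1
      (oneCocycleClass ((W.twistedTorsionGaloisModule p κ J u hu).tateDual (p ^ J)).toTopRep φ) = 0 := by
  -- descend `m` through `π`: `m = m' ∘ π`
  obtain ⟨m', hm'π⟩ := W.exists_tateDual_comp_twistedTorsionMulPow_eq p κ hjJ u hu hdiv hjm
  -- and `ι^D ∘ φ = ∂m'`
  rw [galoisCohomology.map_one_oneCocycleClass]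
  refine (oneCocycleClass_eq_zero_iff _ _).mpr ⟨m', fun g ↦ ?_⟩
  refine TateDual.ext fun S ↦ ?_
  obtain ⟨S₁, rfl⟩ := W.twistedTorsionMulPow_surjective p κ hjJ u hu hdiv S
  change W.twistedTorsionInclDual p κ hjJ u hu (φ.1 g) (W.twistedTorsionMulPow p κ hjJ u hu S₁) =
    ((W.twistedTorsionGaloisModule p κ j u hu).tateDual (p ^ J) g m' - m') (W.twistedTorsionMulPow p κ hjJ u hu S₁)
  rw [twistedTorsionInclDual_apply_apply, twistedTorsionIncl_mulPow, map_zsmul]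
  have hL : ((p ^ (J - j) : ℕ) : ℤ) • φ.1 g S₁ =
      (((W.twistedTorsionGaloisModule p κ J u hu).tateDual (p ^ J)) g m - m) S₁ := by
    rw [← hm' g]; rfl
  rw [hL]
  change (((W.twistedTorsionGaloisModule p κ J u hu).tateDual (p ^ J)) g m) S₁ - m S₁ =
    ((W.twistedTorsionGaloisModule p κ j u hu).tateDual (p ^ J) g m') (W.twistedTorsionMulPow p κ hjJ u hu S₁) -
      m' (W.twistedTorsionMulPow p κ hjJ u hu S₁)
  rw [hm'π, DiscreteGaloisModule.tateDual_apply_apply_apply, DiscreteGaloisModule.tateDual_apply_apply_apply,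
    ← twistedTorsionMulPow_apply_twist, hm'π]

end Tail

/-! ## §2 The new local input: `σ₀`-fixed elements of `Hom(C(χ_u), μ_{p^J})` are killed by `u − 1` -/

section LineDual

variable {K : Type} [Field K] [NumberField K] (W : WeierstrassCurve K) (p : ℕ) [hp : Fact p.Prime]
  (κ : ZpExtension K p) (J : ℕ) (u : ℤ) (hu : (p : ℤ) ∣ u - 1) {v : HeightOneSpectrum (𝓞 K)}
  [Finite (W.geomTorsion ((p ^ J : ℕ) : ℤ))]
  (C : Submodule ℤ (W.geomTorsion ((p ^ J : ℕ) : ℤ)))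
  (hCu : ∀ σ : absoluteGaloisGroup (v.adicCompletion K), C ≤ C.comap
    (((W.twistedTorsionGaloisModule p κ J u hu).restrict (absGaloisRestrict K (v.adicCompletion K))) σ))

/-- **A `σ₀`-fixed homomorphism `f : C(χ_u) → μ_{p^J}` is killed by `u − 1` at every value**, when `σ₀ ∈ Γ_{K_v}` lies over the
topological generator (`κ(σ₀|_K) = γ`) and acts on the line `C` through its exponent `a` on `μ_{p^J}(K̄_v)` («`σ₀ ζ = ζ^a ⟹ σ₀ c = a c`»,
the Tate-line package (iv)): `a·f(c) = σ₀ f(c) = f(σ₀ ⋆ c) = f(u a c) = u a·f(c)` and `a` is invertible on `μ_{p^J}` — the computation of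
XXXVIII `natCard_two_line_le`, any number field, any `p`. [cite: GreenbergLNM1716, §4 pp. 107, 124–125]
[cite: SerreGaloisCohomology1997, II §5.2] -/
theorem sub_one_zsmul_homRep_line_apply_eq_zero (σ₀ : absoluteGaloisGroup (v.adicCompletion K))
    (hσ₀ : κ (resGal (K := K) (v.adicCompletion K) σ₀) = Multiplicative.ofAdd 1)
    (hσ₀C : ∀ a : ℕ, (∀ ζ : (AlgebraicClosure (v.adicCompletion K))ˣ, ζ ^ p ^ J = 1 →
        Units.map (Field.absoluteGaloisGroup.toAlgEquiv (v.adicCompletion K) σ₀ :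
          AlgebraicClosure (v.adicCompletion K) →* AlgebraicClosure (v.adicCompletion K)) ζ = ζ ^ a) →
      ∀ c ∈ C, absGaloisRestrict K (v.adicCompletion K) σ₀ • c = a • c)
    (f : HomCarrier C (MuCarrier (v.adicCompletion K) (p ^ J)))
    (hf : ((((W.twistedTorsionGaloisModule p κ J u hu).restrict
        (absGaloisRestrict K (v.adicCompletion K))).subrepresentation C hCu).homRep
        (mu (v.adicCompletion K) (p ^ J))) σ₀ f = f)
    (c : C) : (u - 1) • f c = 0 := by
  haveI : NeZero (p ^ J) := ⟨pow_ne_zero _ hp.out.ne_zero⟩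
  set R := (W.twistedTorsionGaloisModule p κ J u hu).restrict (absGaloisRestrict K (v.adicCompletion K)) with hR
  set RC := R.subrepresentation C hCu with hRC
  -- the exponent `a` of `σ₀` on `μ_{p^J}`, with inverse `a'`
  obtain ⟨a, a', ha, haa'⟩ := exists_exponent_rootsOfUnity σ₀ (p ^ J)
  have hCσ := hσ₀C a ha
  -- the twisted action of `σ₀` on `C`: `σ₀ ⋆ c = u • σ₀ c = (u a) • c`
  have hRσ : ∀ c : C, (RC σ₀ c : C) = (u * a : ℤ) • c := by
    intro c
    apply Subtype.ext
    change W.twistedTorsionGaloisModule p κ J u hu (absGaloisRestrict K (v.adicCompletion K) σ₀)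
      (c : W.geomTorsion ((p ^ J : ℕ) : ℤ)) = (((u * a : ℤ) • c : C) : W.geomTorsion ((p ^ J : ℕ) : ℤ))
    erw [ZpExtension.galoisTwist_apply_of_isTopGenerator _ _ _ _ _ _ hσ₀, torsionGaloisModule_apply_apply]
    rw [WeierstrassCurve.resGal_eq_absGaloisRestrict, hCσ _ c.2, Submodule.coe_smul, mul_smul, natCast_zsmul]
  -- the action of `σ₀` on `μ_{p^J}`: `σ₀ ζ = a • ζ`, and `(a a') • ζ = ζ`
  have hμσ : ∀ ζ : MuCarrier (v.adicCompletion K) (p ^ J), mu (v.adicCompletion K) (p ^ J) σ₀ ζ = a • ζ := by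
    intro ζ
    have hζ : ((MuCarrier.toAdditive ζ).toMul : (AlgebraicClosure (v.adicCompletion K))ˣ) ^ p ^ J = 1 :=
      (mem_rootsOfUnity _ _).1 (MuCarrier.toAdditive ζ).toMul.2
    apply MuCarrier.toAdditive.injective
    rw [DiscreteGaloisModule.mu_apply_apply]
    change Additive.ofMul (σ₀ • (MuCarrier.toAdditive ζ).toMul) =
      Additive.ofMul ((MuCarrier.toAdditive ζ).toMul ^ a)
    congr 1
    apply Subtype.ext
    rw [Field.absoluteGaloisGroup.coe_smul_rootsOfUnity, SubmonoidClass.coe_pow, ← ha _ hζ]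
    exact Units.ext rfl
  have hμaa : ∀ ζ : MuCarrier (v.adicCompletion K) (p ^ J), (a * a') • ζ = ζ := by
    intro ζ
    have hζ : ((MuCarrier.toAdditive ζ).toMul : (AlgebraicClosure (v.adicCompletion K))ˣ) ^ p ^ J = 1 :=
      (mem_rootsOfUnity _ _).1 (MuCarrier.toAdditive ζ).toMul.2
    apply MuCarrier.toAdditive.injective
    change Additive.ofMul ((MuCarrier.toAdditive ζ).toMul ^ (a * a')) = Additive.ofMul (MuCarrier.toAdditive ζ).toMul
    congr 1
    exact Subtype.ext (by rw [SubmonoidClass.coe_pow]; exact haa' _ hζ)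
  -- the fixed `f` is equivariant: `a • f c = f (σ₀ ⋆ c) = (u a) • f c`
  have h1 : mu (v.adicCompletion K) (p ^ J) σ₀ (f c) = f (RC σ₀ c) :=
    (ContinuousRep.homRep_apply_eq_self_iff RC _ σ₀ f).1 hf c
  rw [hμσ, hRσ, map_zsmul, ← natCast_zsmul] at h1
  have h2 : ((a : ℤ) * (u - 1)) • f c = 0 := by
    rw [show (a : ℤ) * (u - 1) = u * a - a by ring, sub_smul, ← h1, sub_self]
  calc (u - 1) • f c = (u - 1) • (((a * a' : ℕ) : ℤ) • f c) := by rw [natCast_zsmul, hμaa]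
    _ = (a' : ℤ) • (((a : ℤ) * (u - 1)) • f c) := by
        rw [smul_smul, smul_smul]; congr 1; push_cast; ring
    _ = 0 := by rw [h2, smul_zero]

/-- **Hence `p^{|u−1|} · f = 0`** for such a `σ₀`-fixed `f ∈ Hom(C(χ_u), μ_{p^J})` when `u ≠ 1`: `f` has `p`-power order (its values are
`p^J`-torsion) dividing `|u − 1| < p^{|u−1|}`. This is the uniform exponent replacing Greenberg's «`H⁰(F_{v₀}, M*)` finite» (p. 125) at
the place above `p`. [cite: GreenbergLNM1716, §4 pp. 124–125] [cite: SerreGaloisCohomology1997, II §5.2] -/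
theorem pow_natAbs_smul_eq_zero_of_homRep_line_apply_eq_self (σ₀ : absoluteGaloisGroup (v.adicCompletion K))
    (hσ₀ : κ (resGal (K := K) (v.adicCompletion K) σ₀) = Multiplicative.ofAdd 1)
    (hσ₀C : ∀ a : ℕ, (∀ ζ : (AlgebraicClosure (v.adicCompletion K))ˣ, ζ ^ p ^ J = 1 →
        Units.map (Field.absoluteGaloisGroup.toAlgEquiv (v.adicCompletion K) σ₀ :
          AlgebraicClosure (v.adicCompletion K) →* AlgebraicClosure (v.adicCompletion K)) ζ = ζ ^ a) →
      ∀ c ∈ C, absGaloisRestrict K (v.adicCompletion K) σ₀ • c = a • c)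
    (hu1 : u ≠ 1)
    (f : HomCarrier C (MuCarrier (v.adicCompletion K) (p ^ J)))
    (hf : ((((W.twistedTorsionGaloisModule p κ J u hu).restrict
        (absGaloisRestrict K (v.adicCompletion K))).subrepresentation C hCu).homRep
        (mu (v.adicCompletion K) (p ^ J))) σ₀ f = f) :
    p ^ (u - 1).natAbs • f = 0 := by
  haveI : NeZero (p ^ J) := ⟨pow_ne_zero _ hp.out.ne_zero⟩
  have hC0 : ∀ c : C, p ^ J • (c : C) = 0 := fun c ↦ Subtype.ext (by
    rw [Submodule.coe_smul_of_tower, Submodule.coe_zero]; exact W.pow_nsmul_geomTorsion_pow p J _)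
  -- `(u - 1) • f = 0` and `p^J • f = 0`
  have hkill : (u - 1) • f = 0 := HomCarrier.ext fun c ↦ by
    rw [HomCarrier.zero_apply]
    exact sub_one_zsmul_homRep_line_apply_eq_zero W p κ J u hu C hCu σ₀ hσ₀ hσ₀C f hf c
  have hJ : p ^ J • f = 0 := HomCarrier.ext fun c ↦ by
    rw [HomCarrier.zero_apply]
    change p ^ J • f c = 0
    rw [← map_nsmul, hC0 c, map_zero]
  -- the order of `f` is a power of `p` dividing `d = |u - 1| < p^d`
  set d := (u - 1).natAbs with hd
  have hd0 : 0 < d := Int.natAbs_pos.2 (sub_ne_zero.2 hu1)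
  have hdkill : d • f = 0 := by
    rcases Int.natAbs_eq (u - 1) with h' | h'
    · rw [h', natCast_zsmul] at hkill; exact hkill
    · rw [h', neg_smul, neg_eq_zero, natCast_zsmul] at hkill; exact hkill
  obtain ⟨b, -, hb⟩ := (Nat.dvd_prime_pow hp.out).1 (addOrderOf_dvd_iff_nsmul_eq_zero.2 hJ)
  have hbd : p ^ b ∣ d := hb ▸ addOrderOf_dvd_iff_nsmul_eq_zero.2 hdkill
  have hble : b < d := by
    have h1 : p ^ b ≤ d := Nat.le_of_dvd hd0 hbd
    by_contra h
    push Not at h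
    have h2 : d < p ^ b := lt_of_lt_of_le (Nat.lt_pow_self hp.out.one_lt) (Nat.pow_le_pow_right hp.out.pos h)
    omega
  obtain ⟨k, hk⟩ := Nat.exists_eq_add_of_le hble.le
  rw [hk, pow_add, mul_comm, mul_smul, ← hb, addOrderOf_nsmul_eq_zero, smul_zero]

end LineDual

/-! ## §3 The model hypothesis from its `p`-torsion form -/

section Model

variable {K : Type} [Field K] (W : WeierstrassCurve K) (p : ℕ) [hp : Fact p.Prime] (κ : ZpExtension K p)
  (N : AddSubgroup (W.geomPrimaryTorsion p))

/-- **The model hypothesis at every level `J` and every twist `u'` from «no `Γ_K`-fixed point of order `p` on the line».**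
If every `P` on the line `N ⊆ E[p^∞]` with `p · P = 0` fixed by `Γ_K` is `0`, then for every `J` and every `u' ≡ 1 (mod p)` every
point `R ∈ E[p^J]` on the line fixed by the `u'`-TWISTED action of `Γ_K` is `0`: otherwise some multiple `p^t R` has order `p`, lies on
the line, and is twisted-fixed, and on a point killed by `p` the twist factor `u'^{κ(g) mod p^J} ≡ 1 (mod p)` acts trivially.
(For `E/ℚ`, `p = 2`, `E(ℚ)[2] = {0, P₀}`: the hypothesis is «`P₀ ∉ C`»; for `E(K)[p] = 0` it is vacuous.)
[cite: GreenbergLNM1716, §4 Prop. 4.13 (p. 122)] [cite: GreenbergVatsal2000, §2 p. 18] -/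
theorem forall_twisted_apply_eq_self_line_eq_zero_of_prime_torsion
    (hN : ∀ P ∈ N, p • P = 0 → (∀ g : absoluteGaloisGroup K, g • P = P) → P = 0)
    (J : ℕ) {u' : ℤ} (hu' : (p : ℤ) ∣ u' - 1) (R : W.geomTorsion ((p ^ J : ℕ) : ℤ))
    (hR : AddSubgroup.inclusion (Literature.Barriers.BirchSwinnertonDyer.geomTorsion_pow_le_geomPrimaryTorsion W p J) R ∈ N)
    (hfix : ∀ g : absoluteGaloisGroup K, W.twistedTorsionGaloisModule p κ J u' hu' g R = R) : R = 0 := by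
  set ι := AddSubgroup.inclusion (Literature.Barriers.BirchSwinnertonDyer.geomTorsion_pow_le_geomPrimaryTorsion W p J)
    with hιdef
  -- the untwisted action on `R`: `g • R = u'^{-e} ⋆ … `; we only need: `g • (n • R) = n • (g ⋆ R)`-type bookkeeping below
  -- strong induction on the exponent: the least `t` with `p^t • R = 0`
  have hRJ : p ^ J • R = 0 := W.pow_nsmul_geomTorsion_pow p J R
  classical
  by_contra hR0
  -- the least `t` with `p^t • R = 0` is positive
  have hex : ∃ t, p ^ t • R = 0 := ⟨J, hRJ⟩
  set t := Nat.find hex with ht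
  have htR : p ^ t • R = 0 := Nat.find_spec hex
  have ht0 : t ≠ 0 := by
    intro h
    rw [h, pow_zero, one_smul] at htR
    exact hR0 htR
  obtain ⟨s, hs⟩ := Nat.exists_eq_add_one_of_ne_zero ht0
  -- `P := p^s • R` has `p • P = 0`, `P ≠ 0`
  set P : W.geomTorsion ((p ^ J : ℕ) : ℤ) := p ^ s • R with hPdef
  have hpP : p • P = 0 := by rw [hPdef, smul_smul, ← pow_succ', ← hs, htR]
  have hP0 : P ≠ 0 := by
    intro h
    have hmin := Nat.find_min hex (show s < t by omega)
    exact hmin h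
  -- `P` is on the line and twisted-fixed
  have hPN : ι P ∈ N := by rw [hPdef, map_nsmul]; exact N.nsmul_mem hR _
  have hPfix : ∀ g : absoluteGaloisGroup K, W.twistedTorsionGaloisModule p κ J u' hu' g P = P := fun g ↦ by
    rw [hPdef, map_nsmul, hfix g]
  -- on `P` the twist is invisible: `g • P = P`
  have hPfix' : ∀ g : absoluteGaloisGroup K, g • ι P = ι P := by
    intro g
    have h1 := hPfix g
    rw [ZpExtension.galoisTwist_apply_apply, torsionGaloisModule_apply_apply] at h1
    -- `h1 : u'^e • (g • P) = P`; as `p • (g • P) = 0` and `p ∣ u'^e - 1`, `u'^e • (g • P) = g • P`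
    have hpg : p • (g • P) = 0 := by rw [smul_comm, hpP, smul_zero]
    have hdvd : (p : ℤ) ∣ u' ^ κ.twistExponent J g - 1 :=
      hu'.trans (by simpa only [one_pow] using sub_dvd_pow_sub_pow u' 1 (κ.twistExponent J g))
    obtain ⟨c, hc⟩ := hdvd
    have h2 : (u' ^ κ.twistExponent J g) • (g • P) = g • P := by
      have h3 : (u' ^ κ.twistExponent J g - 1) • (g • P) = 0 := by
        rw [hc, mul_comm, mul_smul, natCast_zsmul, hpg, smul_zero]
      rwa [sub_smul, one_smul, sub_eq_zero] at h3
    rw [h2] at h1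
    have h4 : ι (g • P) = g • ι P := Subtype.ext rfl
    rw [← h4, h1]
  have hιP : p • ι P = 0 := by rw [← map_nsmul, hpP, map_zero]
  have h0 : ι P = 0 := hN _ hPN hιP hPfix'
  exact hP0 ((AddSubgroup.inclusion_injective _) (h0.trans (map_zero _).symm))

end Model

end Summit.BirchSwinnertonDyer.BirchSwinnertonDyer.Theorems.MultTransportTwistedDescent

end
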